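import Summits.CriticalPhenomena.PercolationContinuityZ3.Theorems.PercNearOneGluingNoHeavyLowerTailIncStarRootStarMixture
import HarnessLib

/-!
# The INNER edge induction for the root-star mixture slack ("(MQ-Bern) ⟹ (MQ) ⟹ increasing star")

Support file for the Sahi programme (`--supports stmt-CriticalPhenomena-4575`, prover prim-sahi-p2 gen 16).  No definitions, no named
facts, no sorries; standard axioms.  Memo `run/shared/lean/prim/prim-sahi/FROM-prim-sahi-p2-gen16-CURVATURE-MAP-SHARP-FORM.md` §(D),
`prim-sahi-p2/PROOF-E3.md` §26h–26k.

Notation as in `PercNearOneGluingNoHeavyLowerTailIncStarRootStarMixture`: root `s`, targets `b c y`, `F` the fractional non-loop pairs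
at `s`, `w^O` (`O ⊆ F`) the weight pinned to `1` on `O`, to `0` on `F ∖ O`, equal to `w` elsewhere, `π(O) = Π_{e∈O} w e · Π_{e∈F∖O}(1 − w e)`,
`T(w) = E₃({s↔b},{s↔c},{s↔y})` under `prodBernoulli w`, and the ROOT-STAR MIXTURE SLACK `Φ(w) = T(w) − Σ_{O⊆F} π(O) T(w^O)`; the conjecture
`(MQ)` is `Φ ≥ 0` and gives the increasing star (`IncStar.incStar_nonneg_of_rootStarMixture`).

Along a NON-ROOT pair `e` (`s ∉ e`) everything in `Φ` except the laws is constant: `F`, `π` and the pinning do not involve `w e`, and each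
`T` is a Bernstein cubic in `w e` (`EdgeInduction.sahiE3_oneBond`).  Hence `Φ(w) = (1−p)³Φ(w[e↦0]) + 3p(1−p)²·B₁ + 3p²(1−p)·B₂ + p³Φ(w[e↦1])`
with `p = w e` and the MIXED SLACK COEFFICIENTS
`B₁ = polar₁(P_{w[e↦0]}, P_{w[e↦1]}) − Σ_O π(O)·polar₁(P_{w^O[e↦0]}, P_{w^O[e↦1]})`, `B₂` = the same with `0, 1` exchanged
("(MQ) for the polar forms").  The conjecture

  `(MQ-Bern)   B₁ ≥ 0 and B₂ ≥ 0 at every non-root non-loop pair of every weighted graph`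

(prim-sahi-p2 gen 16: 0 failures in 683 random (graph, pair) cases with ≤ 8 vertices, at every non-root pair of the bypass graphs `W2(3)`,
`W2(4)` that refute all single-pair chord/concavity relations, and in a wider structured census — see the memo; the chord property and
concavity of `Φ` along `e` fail in about 70 % of the same cases) therefore gives `(MQ)` by induction on the number of fractional non-root
non-loop pairs, from the BASE CASE in which every non-root non-loop pair has weight `0` or `1` (then every `w^O` is deterministic off the
loops, `T(w^O) = 0`, and `(MQ)` reads `T(w) ≥ 0` for a "star of blocks").

**Theorems.** `rootStarMixture_of_slackEdgeBernstein`: `(MQ-Bern)` and the base case imply `(MQ)` for every weight, root and targets;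
`incStar_nonneg_of_slackEdgeBernstein`: hence the increasing star.  Both hypotheses are stated in full (no definitions); nothing here
asserts them.
-/

noncomputable section

namespace Summit.CriticalPhenomena.PercolationContinuityZ3.Theorems

namespace IncStar

open Finset MeasureTheory Literature.Probability.Percolation Literature.Probability.LatticeModels EdgeInduction
open scoped Classical

variable {n : ℕ}

/-- Pinning a pair that misses the root does not change the set of fractional non-loop ROOT pairs. [folklore] -/
theorem rootFrac_update_eq (w : Sym2 (Fin n) → unitInterval) (s : Fin n) {e : Sym2 (Fin n)} (hse : s ∉ e) (v : unitInterval) :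
    ((fracEdges (Function.update w e v)).filter fun f => ¬ f.IsDiag ∧ s ∈ f) =
      ((fracEdges w).filter fun f => ¬ f.IsDiag ∧ s ∈ f) := by
  ext f
  simp only [Finset.mem_filter]
  by_cases hfe : f = e
  · subst hfe
    exact ⟨fun h => absurd h.2.2 hse, fun h => absurd h.2.2 hse⟩
  · have h : f ∈ fracEdges (Function.update w e v) ↔ f ∈ fracEdges w := by
      simp only [fracEdges, Finset.mem_filter, Finset.mem_univ, true_and, Function.update_of_ne hfe]
    rw [h]

/-- Pinning a fractional non-loop pair that misses the root lowers the number of fractional non-loop NON-ROOT pairs. [folklore] -/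
theorem card_nonRootFrac_update_lt (w : Sym2 (Fin n) → unitInterval) (s : Fin n) {e : Sym2 (Fin n)} (he : e ∈ fracEdges w)
    (hd : ¬ e.IsDiag) (hse : s ∉ e) (v : unitInterval) (hv : v = 0 ∨ v = 1) :
    ((fracEdges (Function.update w e v)).filter fun f => ¬ f.IsDiag ∧ s ∉ f).card <
      ((fracEdges w).filter fun f => ¬ f.IsDiag ∧ s ∉ f).card := by
  have hsub : ((fracEdges (Function.update w e v)).filter fun f => ¬ f.IsDiag ∧ s ∉ f) ⊆
      ((fracEdges w).filter fun f => ¬ f.IsDiag ∧ s ∉ f).erase e := by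
    intro f hf
    rw [Finset.mem_filter] at hf
    have h1 := fracEdges_update_subset w e v hv hf.1
    rw [Finset.mem_erase] at h1 ⊢
    exact ⟨h1.1, Finset.mem_filter.2 ⟨h1.2, hf.2⟩⟩
  have hmem : e ∈ ((fracEdges w).filter fun f => ¬ f.IsDiag ∧ s ∉ f) := Finset.mem_filter.2 ⟨he, hd, hse⟩
  have h1 := Finset.card_le_card hsub
  rw [Finset.card_erase_of_mem hmem] at h1
  have hpos := Finset.card_pos.2 ⟨_, hmem⟩
  omega

/-- Pinning the root pairs commutes with updating a pair outside them. [folklore] -/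
theorem pin_update_comm (w : Sym2 (Fin n) → unitInterval) {F O : Finset (Sym2 (Fin n))} (hO : O ⊆ F) {e : Sym2 (Fin n)}
    (he : e ∉ F) (v : unitInterval) :
    (fun f => if f ∈ O then (1 : unitInterval) else if f ∈ F then 0 else Function.update w e v f) =
      Function.update (fun f => if f ∈ O then (1 : unitInterval) else if f ∈ F then 0 else w f) e v := by
  funext f
  by_cases hfe : f = e
  · subst hfe
    rw [Function.update_self, Function.update_self, if_neg (fun h => he (hO h)), if_neg he]
  · rw [Function.update_of_ne hfe, Function.update_of_ne hfe]

/-- Distributing a weighted sum over a four-term combination. [folklore] -/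
theorem sum_mul_cubic {ι : Type*} (S : Finset ι) (π X Y Z W : ι → ℝ) (c₀ c₁ c₂ c₃ : ℝ) :
    ∑ O ∈ S, π O * (c₀ * X O + c₁ * Y O + c₂ * Z O + c₃ * W O) =
      c₀ * ∑ O ∈ S, π O * X O + c₁ * ∑ O ∈ S, π O * Y O + c₂ * ∑ O ∈ S, π O * Z O + c₃ * ∑ O ∈ S, π O * W O := by
  simp only [Finset.mul_sum, ← Finset.sum_add_distrib]
  exact Finset.sum_congr rfl fun O _ => by ring

/-- **A mixture of `E₃`'s along one pair is a Bernstein cubic**: if every law of the mixture gives the pair `e` the weight `w e`, the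
mixture `Σ_O π(O)·E₃(P_O)` expands along `e` with extreme coefficients the mixtures under `e ↦ 0`, `e ↦ 1` and mixed coefficients the
mixtures of `polar₁`. [this work] -/
theorem sum_sahiE3_oneBond (w : Sym2 (Fin n) → unitInterval) (e : Sym2 (Fin n)) {ι : Type*} (S : Finset ι) (π : ι → ℝ)
    (P : ι → Sym2 (Fin n) → unitInterval) (hP : ∀ O ∈ S, P O e = w e) (A B C : Set (BondConfig (Fin n))) :
    ∑ O ∈ S, π O * sahiE3 (prodBernoulli (P O)) A B C =
      (1 - (w e : ℝ)) ^ 3 * ∑ O ∈ S, π O * sahiE3 (prodBernoulli (Function.update (P O) e 0)) A B C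
      + 3 * (w e : ℝ) * (1 - (w e : ℝ)) ^ 2 *
          ∑ O ∈ S, π O * polar₁ (prodBernoulli (Function.update (P O) e 0)) (prodBernoulli (Function.update (P O) e 1)) A B C
      + 3 * (w e : ℝ) ^ 2 * (1 - (w e : ℝ)) *
          ∑ O ∈ S, π O * polar₁ (prodBernoulli (Function.update (P O) e 1)) (prodBernoulli (Function.update (P O) e 0)) A B C
      + (w e : ℝ) ^ 3 * ∑ O ∈ S, π O * sahiE3 (prodBernoulli (Function.update (P O) e 1)) A B C := by
  rw [← sum_mul_cubic S π (fun O => sahiE3 (prodBernoulli (Function.update (P O) e 0)) A B C)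
    (fun O => polar₁ (prodBernoulli (Function.update (P O) e 0)) (prodBernoulli (Function.update (P O) e 1)) A B C)
    (fun O => polar₁ (prodBernoulli (Function.update (P O) e 1)) (prodBernoulli (Function.update (P O) e 0)) A B C)
    (fun O => sahiE3 (prodBernoulli (Function.update (P O) e 1)) A B C)]
  refine Finset.sum_congr rfl fun O hO => ?_
  rw [sahiE3_oneBond (P O) e A B C, hP O hO]

/-- Along a pair missing the root, the root-star mixture of the pinned weight `w[e↦v]` is the mixture, with the weights `π(O)` of `w`,
of `E₃` under the pinned-then-updated weights `w^O[e↦v]`. [this work] -/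
theorem rootStarMixture_update (w : Sym2 (Fin n) → unitInterval) (s b c y : Fin n) {e : Sym2 (Fin n)} (hse : s ∉ e)
    (v : unitInterval) :
    ∑ O ∈ ((fracEdges (Function.update w e v)).filter fun f => ¬ f.IsDiag ∧ s ∈ f).powerset,
        (∏ f ∈ O, (Function.update w e v f : ℝ)) *
          (∏ f ∈ ((fracEdges (Function.update w e v)).filter fun f => ¬ f.IsDiag ∧ s ∈ f) \ O,
            (1 - (Function.update w e v f : ℝ))) *
          sahiE3 (prodBernoulli (fun f => if f ∈ O then (1 : unitInterval)
              else if f ∈ ((fracEdges (Function.update w e v)).filter fun f => ¬ f.IsDiag ∧ s ∈ f) then 0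
              else Function.update w e v f))
            (openConn s b) (openConn s c) (openConn s y) =
      ∑ O ∈ ((fracEdges w).filter fun f => ¬ f.IsDiag ∧ s ∈ f).powerset,
        (∏ f ∈ O, (w f : ℝ)) * (∏ f ∈ ((fracEdges w).filter fun f => ¬ f.IsDiag ∧ s ∈ f) \ O, (1 - (w f : ℝ))) *
          sahiE3 (prodBernoulli (Function.update (fun f => if f ∈ O then (1 : unitInterval)
              else if f ∈ ((fracEdges w).filter fun f => ¬ f.IsDiag ∧ s ∈ f) then 0 else w f) e v))
            (openConn s b) (openConn s c) (openConn s y) := by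
  rw [rootFrac_update_eq w s hse v]
  have heF : e ∉ (fracEdges w).filter fun f => ¬ f.IsDiag ∧ s ∈ f := fun h => hse (Finset.mem_filter.1 h).2.2
  refine Finset.sum_congr rfl fun O hO => ?_
  have hOF := Finset.mem_powerset.1 hO
  have hne : ∀ f ∈ (fracEdges w).filter (fun f => ¬ f.IsDiag ∧ s ∈ f), f ≠ e := fun f hf h => heF (h ▸ hf)
  have h1 : ∏ f ∈ O, (Function.update w e v f : ℝ) = ∏ f ∈ O, (w f : ℝ) :=
    Finset.prod_congr rfl fun f hf => by rw [Function.update_of_ne (hne f (hOF hf))]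
  have h2 : ∏ f ∈ ((fracEdges w).filter fun f => ¬ f.IsDiag ∧ s ∈ f) \ O, (1 - (Function.update w e v f : ℝ)) =
      ∏ f ∈ ((fracEdges w).filter fun f => ¬ f.IsDiag ∧ s ∈ f) \ O, (1 - (w f : ℝ)) :=
    Finset.prod_congr rfl fun f hf => by rw [Function.update_of_ne (hne f (Finset.sdiff_subset hf))]
  rw [pin_update_comm w hOF heF v, h1, h2]

/-- **THE INNER EDGE INDUCTION ("(MQ-Bern) ⟹ (MQ)").**  Suppose (i) `(MQ-Bern)`: at every non-loop pair `e` missing the root, both mixed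
slack coefficients are nonnegative, i.e. the `π`-mixture of `polar₁` of the pinned-and-updated laws is at most `polar₁` of the updated laws
(both orders of `0, 1`); and (ii) the base case: `(MQ)` whenever every non-loop pair missing the root has weight `0` or `1`.  Then `(MQ)`:
the root-star mixture never exceeds `E₃({s↔b},{s↔c},{s↔y})`, for every weight on `Fin n`, every root and all targets. [this work] -/
theorem rootStarMixture_of_slackEdgeBernstein
    (hBern : ∀ (w : Sym2 (Fin n) → unitInterval) (s b c y : Fin n) (e : Sym2 (Fin n)), ¬ e.IsDiag → s ∉ e →
      (∑ O ∈ ((fracEdges w).filter fun f => ¬ f.IsDiag ∧ s ∈ f).powerset,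
          (∏ f ∈ O, (w f : ℝ)) * (∏ f ∈ ((fracEdges w).filter fun f => ¬ f.IsDiag ∧ s ∈ f) \ O, (1 - (w f : ℝ))) *
            polar₁ (prodBernoulli (Function.update (fun f => if f ∈ O then (1 : unitInterval)
                else if f ∈ ((fracEdges w).filter fun f => ¬ f.IsDiag ∧ s ∈ f) then 0 else w f) e 0))
              (prodBernoulli (Function.update (fun f => if f ∈ O then (1 : unitInterval)
                else if f ∈ ((fracEdges w).filter fun f => ¬ f.IsDiag ∧ s ∈ f) then 0 else w f) e 1))
              (openConn s b) (openConn s c) (openConn s y) ≤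
        polar₁ (prodBernoulli (Function.update w e 0)) (prodBernoulli (Function.update w e 1))
          (openConn s b) (openConn s c) (openConn s y)) ∧
      (∑ O ∈ ((fracEdges w).filter fun f => ¬ f.IsDiag ∧ s ∈ f).powerset,
          (∏ f ∈ O, (w f : ℝ)) * (∏ f ∈ ((fracEdges w).filter fun f => ¬ f.IsDiag ∧ s ∈ f) \ O, (1 - (w f : ℝ))) *
            polar₁ (prodBernoulli (Function.update (fun f => if f ∈ O then (1 : unitInterval)
                else if f ∈ ((fracEdges w).filter fun f => ¬ f.IsDiag ∧ s ∈ f) then 0 else w f) e 1))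
              (prodBernoulli (Function.update (fun f => if f ∈ O then (1 : unitInterval)
                else if f ∈ ((fracEdges w).filter fun f => ¬ f.IsDiag ∧ s ∈ f) then 0 else w f) e 0))
              (openConn s b) (openConn s c) (openConn s y) ≤
        polar₁ (prodBernoulli (Function.update w e 1)) (prodBernoulli (Function.update w e 0))
          (openConn s b) (openConn s c) (openConn s y)))
    (hBase : ∀ (w : Sym2 (Fin n) → unitInterval) (s b c y : Fin n),
      (∀ e : Sym2 (Fin n), ¬ e.IsDiag → s ∉ e → w e = 0 ∨ w e = 1) →
      ∑ O ∈ ((fracEdges w).filter fun f => ¬ f.IsDiag ∧ s ∈ f).powerset,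
          (∏ f ∈ O, (w f : ℝ)) * (∏ f ∈ ((fracEdges w).filter fun f => ¬ f.IsDiag ∧ s ∈ f) \ O, (1 - (w f : ℝ))) *
            sahiE3 (prodBernoulli (fun f => if f ∈ O then (1 : unitInterval)
                else if f ∈ ((fracEdges w).filter fun f => ¬ f.IsDiag ∧ s ∈ f) then 0 else w f))
              (openConn s b) (openConn s c) (openConn s y) ≤
        sahiE3 (prodBernoulli w) (openConn s b) (openConn s c) (openConn s y)) :
    ∀ (w : Sym2 (Fin n) → unitInterval) (s b c y : Fin n),
      ∑ O ∈ ((fracEdges w).filter fun f => ¬ f.IsDiag ∧ s ∈ f).powerset,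
          (∏ f ∈ O, (w f : ℝ)) * (∏ f ∈ ((fracEdges w).filter fun f => ¬ f.IsDiag ∧ s ∈ f) \ O, (1 - (w f : ℝ))) *
            sahiE3 (prodBernoulli (fun f => if f ∈ O then (1 : unitInterval)
                else if f ∈ ((fracEdges w).filter fun f => ¬ f.IsDiag ∧ s ∈ f) then 0 else w f))
              (openConn s b) (openConn s c) (openConn s y) ≤
        sahiE3 (prodBernoulli w) (openConn s b) (openConn s c) (openConn s y) := by
  -- induction on the number of fractional non-loop NON-ROOT pairs
  suffices H : ∀ (k : ℕ) (w : Sym2 (Fin n) → unitInterval) (s : Fin n),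
      ((fracEdges w).filter fun f => ¬ f.IsDiag ∧ s ∉ f).card ≤ k → ∀ b c y : Fin n,
      ∑ O ∈ ((fracEdges w).filter fun f => ¬ f.IsDiag ∧ s ∈ f).powerset,
          (∏ f ∈ O, (w f : ℝ)) * (∏ f ∈ ((fracEdges w).filter fun f => ¬ f.IsDiag ∧ s ∈ f) \ O, (1 - (w f : ℝ))) *
            sahiE3 (prodBernoulli (fun f => if f ∈ O then (1 : unitInterval)
                else if f ∈ ((fracEdges w).filter fun f => ¬ f.IsDiag ∧ s ∈ f) then 0 else w f))
              (openConn s b) (openConn s c) (openConn s y) ≤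
        sahiE3 (prodBernoulli w) (openConn s b) (openConn s c) (openConn s y) from
    fun w s b c y => H _ w s le_rfl b c y
  intro k
  induction k with
  | zero =>
      intro w s hk b c y
      refine hBase w s b c y fun e hd hse => eq_zero_or_one_of_not_mem_fracEdges fun hmem => ?_
      have : 0 < ((fracEdges w).filter fun f => ¬ f.IsDiag ∧ s ∉ f).card :=
        Finset.card_pos.2 ⟨e, Finset.mem_filter.2 ⟨hmem, hd, hse⟩⟩
      omega
  | succ k ih =>
      intro w s hk b c y
      by_cases hex : ∃ e ∈ fracEdges w, ¬ e.IsDiag ∧ s ∉ e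
      · obtain ⟨e, he, hd, hse⟩ := hex
        have heF : e ∉ (fracEdges w).filter fun f => ¬ f.IsDiag ∧ s ∈ f := fun h => hse (Finset.mem_filter.1 h).2.2
        obtain ⟨i1, i2⟩ := hBern w s b c y e hd hse
        have i0 := ih (Function.update w e 0) s
          (by have := card_nonRootFrac_update_lt w s he hd hse 0 (Or.inl rfl); omega) b c y
        have i3 := ih (Function.update w e 1) s
          (by have := card_nonRootFrac_update_lt w s he hd hse 1 (Or.inr rfl); omega) b c y
        rw [rootStarMixture_update w s b c y hse 0] at i0
        rw [rootStarMixture_update w s b c y hse 1] at i3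
        have hexp := sum_sahiE3_oneBond w e ((fracEdges w).filter fun f => ¬ f.IsDiag ∧ s ∈ f).powerset
          (fun O => (∏ f ∈ O, (w f : ℝ)) * ∏ f ∈ ((fracEdges w).filter fun f => ¬ f.IsDiag ∧ s ∈ f) \ O, (1 - (w f : ℝ)))
          (fun O f => if f ∈ O then (1 : unitInterval) else if f ∈ ((fracEdges w).filter fun f => ¬ f.IsDiag ∧ s ∈ f) then 0 else w f)
          (fun O hO => by
            show (if e ∈ O then (1 : unitInterval)
              else if e ∈ ((fracEdges w).filter fun f => ¬ f.IsDiag ∧ s ∈ f) then 0 else w e) = w e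
            rw [if_neg (fun h => heF (Finset.mem_powerset.1 hO h)), if_neg heF])
          (openConn s b) (openConn s c) (openConn s y)
        beta_reduce at hexp
        rw [hexp, sahiE3_oneBond w e (openConn s b) (openConn s c) (openConn s y)]
        have hp0 : 0 ≤ (w e : ℝ) := (w e).2.1
        have hp1 : 0 ≤ 1 - (w e : ℝ) := sub_nonneg.2 (w e).2.2
        have c0 : 0 ≤ (1 - (w e : ℝ)) ^ 3 := pow_nonneg hp1 3
        have c1 : 0 ≤ 3 * (w e : ℝ) * (1 - (w e : ℝ)) ^ 2 := by positivity
        have c2 : 0 ≤ 3 * (w e : ℝ) ^ 2 * (1 - (w e : ℝ)) := by positivity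
        have c3 : 0 ≤ (w e : ℝ) ^ 3 := pow_nonneg hp0 3
        exact add_le_add (add_le_add (add_le_add (mul_le_mul_of_nonneg_left i0 c0) (mul_le_mul_of_nonneg_left i1 c1))
          (mul_le_mul_of_nonneg_left i2 c2)) (mul_le_mul_of_nonneg_left i3 c3)
      · push Not at hex
        exact hBase w s b c y fun e hd hse => eq_zero_or_one_of_not_mem_fracEdges fun h => hse (hex e h hd)

/-- **COROLLARY ("(MQ-Bern) ⟹ increasing star").**  Under the two hypotheses of `rootStarMixture_of_slackEdgeBernstein` — the mixed slack
coefficients are nonnegative at every non-loop pair missing the root, and `(MQ)` holds when every such pair is deterministic — the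
increasing star `E₃({s↔b},{s↔c},{s↔y}) ≥ 0` holds for every weight on `Fin n`, every root and all targets
(via `incStar_nonneg_of_rootStarMixture`). [this work] -/
theorem incStar_nonneg_of_slackEdgeBernstein
    (hBern : ∀ (w : Sym2 (Fin n) → unitInterval) (s b c y : Fin n) (e : Sym2 (Fin n)), ¬ e.IsDiag → s ∉ e →
      (∑ O ∈ ((fracEdges w).filter fun f => ¬ f.IsDiag ∧ s ∈ f).powerset,
          (∏ f ∈ O, (w f : ℝ)) * (∏ f ∈ ((fracEdges w).filter fun f => ¬ f.IsDiag ∧ s ∈ f) \ O, (1 - (w f : ℝ))) *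
            polar₁ (prodBernoulli (Function.update (fun f => if f ∈ O then (1 : unitInterval)
                else if f ∈ ((fracEdges w).filter fun f => ¬ f.IsDiag ∧ s ∈ f) then 0 else w f) e 0))
              (prodBernoulli (Function.update (fun f => if f ∈ O then (1 : unitInterval)
                else if f ∈ ((fracEdges w).filter fun f => ¬ f.IsDiag ∧ s ∈ f) then 0 else w f) e 1))
              (openConn s b) (openConn s c) (openConn s y) ≤
        polar₁ (prodBernoulli (Function.update w e 0)) (prodBernoulli (Function.update w e 1))
          (openConn s b) (openConn s c) (openConn s y)) ∧
      (∑ O ∈ ((fracEdges w).filter fun f => ¬ f.IsDiag ∧ s ∈ f).powerset,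
          (∏ f ∈ O, (w f : ℝ)) * (∏ f ∈ ((fracEdges w).filter fun f => ¬ f.IsDiag ∧ s ∈ f) \ O, (1 - (w f : ℝ))) *
            polar₁ (prodBernoulli (Function.update (fun f => if f ∈ O then (1 : unitInterval)
                else if f ∈ ((fracEdges w).filter fun f => ¬ f.IsDiag ∧ s ∈ f) then 0 else w f) e 1))
              (prodBernoulli (Function.update (fun f => if f ∈ O then (1 : unitInterval)
                else if f ∈ ((fracEdges w).filter fun f => ¬ f.IsDiag ∧ s ∈ f) then 0 else w f) e 0))
              (openConn s b) (openConn s c) (openConn s y) ≤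
        polar₁ (prodBernoulli (Function.update w e 1)) (prodBernoulli (Function.update w e 0))
          (openConn s b) (openConn s c) (openConn s y)))
    (hBase : ∀ (w : Sym2 (Fin n) → unitInterval) (s b c y : Fin n),
      (∀ e : Sym2 (Fin n), ¬ e.IsDiag → s ∉ e → w e = 0 ∨ w e = 1) →
      ∑ O ∈ ((fracEdges w).filter fun f => ¬ f.IsDiag ∧ s ∈ f).powerset,
          (∏ f ∈ O, (w f : ℝ)) * (∏ f ∈ ((fracEdges w).filter fun f => ¬ f.IsDiag ∧ s ∈ f) \ O, (1 - (w f : ℝ))) *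
            sahiE3 (prodBernoulli (fun f => if f ∈ O then (1 : unitInterval)
                else if f ∈ ((fracEdges w).filter fun f => ¬ f.IsDiag ∧ s ∈ f) then 0 else w f))
              (openConn s b) (openConn s c) (openConn s y) ≤
        sahiE3 (prodBernoulli w) (openConn s b) (openConn s c) (openConn s y)) :
    ∀ (w : Sym2 (Fin n) → unitInterval) (s b c y : Fin n),
      0 ≤ sahiE3 (prodBernoulli w) (openConn s b) (openConn s c) (openConn s y) :=
  incStar_nonneg_of_rootStarMixture fun w s b c y _ _ => rootStarMixture_of_slackEdgeBernstein hBern hBase w s b c y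

/-! ## Addendum (prim-sahi-p2 gen 18, 2026-08-23): STATUS OF THE HYPOTHESIS — `(MQ-Bern)` IS FALSE

The hypothesis `hBern` of `rootStarMixture_of_slackEdgeBernstein` / `incStar_nonneg_of_slackEdgeBernstein` ('at every non-loop pair missing the root,
both mixed Bernstein coefficients of the root-star mixture slack are nonnegative', `(MQ-Bern)`; gen 16: '0 failures in ≈ 163 000 pairs') is FALSE: it
implies `(MQ)` (this file), and `(MQ)` was refuted exactly in prim-sahi-p2 gen 17 / census §62 — witness A (6 vertices, exact rationals): root `s = 0`, targets `1, 2, 3`, further vertices `o = 4`, `x = 5`; pair weights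
`(s,o) = 1 − 10⁻¹¹`, `(s,2) = 1/2`, `(1,2) = 1/2`, `(o,2) = 1619/1620`, `(2,3) = 3/4`, `(o,x) = 1/4`, `(x,2) = 3/4`, `(x,3) = 1/4` (all other pairs
weight `0`).  There the root-star mixture slack is
`Φ = T(w; s) − Σ_O π(O) T(w^O; s) = −2233727963462351710991103745506326371 / 563585608581120000000000000000000000000000000000 ≈ −3.96·10⁻¹²`
(`T(w; s) ≈ 9.90·10⁻⁵ > 0`; with `(s,o) = 1` exactly, `Φ = −1681/281792804290560`).  Confirmed digit for digit by six independent exact engines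
(prim-sahi-p2 gen 17 `gen17/py/witness_exact.py`; census §62 + addenda: `bern3.py`, `comb/w73/mqn.py`, `comb/w70/mq.py`; lead gen 117 `mqn_graph.py`;
referee R613 `ref613_mq.py`).  MECHANISM (memo FROM-prim-sahi-p2-gen17-MQ-REFUTED-HITTING-C3.md §1.2, `prim-sahi-p2/PROOF-E3.md` §27a–c): give the
root one near-sure pair `(s,r)` and move a sub-star `P` of `r` to `s`; as `w(s,r) → 1` the `(MQ)` instance at `s` degenerates to 'revealing only the
sub-star `P` at `r`', and for `|P| = 1` this is the single-root-pair chord inequality, refuted on the bypass family `W2` (ttrl) — witness B =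
`W2(3)` hub–target with `p(r,h) = 9/10` plus the new root: `Φ = −6.666·10⁻¹³` exactly.  Census §62 gives the closed form
`Φ(ε,p) = λ·ε(1−ε)(1−p)²(1−τ)·[L + (1−τ)·ΔP_c·(1−p)(1+ε)]` with the x-hub defect `L = −41/65536`, and witnesses with all weights in `{1/4, 1/2, 3/4}`
(two-path bundles, 35 vertices).  The defect is tiny (`|Φ|/T ≤ 10⁻⁷`) but its support is an open set of ordinary sparse weighted graphs, so no
weight-bounded / simple-graph / distinct-target restriction of the hypothesis survives.
Directly on witness A: along the non-root pair `e = (o,2)` the slack cubic `Φ(w_e)` has Bernstein coefficients `B₀ = +0.076`, `B₁ = −2.09·10⁻⁵`,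
`B₂ = B₃ = +2.0·10⁻¹²` (prim-sahi-p2 `gen17/py/mqbern_witness.py`; census `ref613b_bern.py`), and `B₂ < 0` along `(2,3)`, `(x,2)`; `B₁ < 0` along `(o,x)`,
`(x,3)`.  CONSEQUENCES: the theorems of this file are correct conditional schemas with an unsatisfiable universal hypothesis; the identities
(`polar₁` bookkeeping, the mixed-coefficient expansion of the slack) are unaffected.  Route status for `stmt-CriticalPhenomena-4575`: CLOSED.
Single-pair Bernstein positivity of `E₃` ITSELF (`B₁, B₂ ≥ 0` of `p_e ↦ E₃`, hypothesis of `…IncStarTargetEdgeInduction`) is NOT affected: it holds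
exactly along all 15 pairs of witness A and has no known failure.
-/

end IncStar

end Summit.CriticalPhenomena.PercolationContinuityZ3.Theorems
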